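import Literature.NumberTheory.EllipticCurves.Kato2004.DivisibilityInputsMultiplicative
import HarnessLib

/-!
# Route ByReductionTypeAtTwo (items 19922 / 19923): the `p = 2` siblings of Kato's multiplicative
# §17.13 input packages — TWO `@[conjecture]` constants (the cell's K11 residue at `2`, typed on Kato's objects)

Seat `bsd-2adic-mult` GEN 9 (HOME `run/shared/lean/pub/bsd-2adic/`, memo `mult/KERNEL-K11-INPUTS.md`;
Literature review of `Kato2004/DivisibilityInputsMultiplicative.lean` (referee-pub-hodgecm2-ref-3 g140):
«add an odd-prime binder to BOTH facts … and leave the `p = 2` extension … as a new conjecture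
obligation `Summits/BirchSwinnertonDyer/…/Theorems/<Name>.lean` with `@[conjecture]` + the memo
pointers — so that any `p = 2` discharge is visibly conditional on a Summit conjecture, not on a
Literature fact»). Theses-free module (pattern of `ByReductionTypeAtTwoOrdKatoIntDefs.lean`): TWO
`@[conjecture]` constants; nothing asserted; no theorem here (the consumers are in
`ByReductionTypeAtTwoMultKatoRatOfInputs.lean`).

* `exists_multDivisibilityInputs_nonsplit_two` — **[K11a residue, MEMO] Kato's §17.13 inputs EXIST at a
  NON-SPLIT multiplicative `2`**: the Literature CONSTRUCTION fact
  `Kato2004.exists_multDivisibilityInputs_nonsplit` (printed at odd `p`: Kato 2004 Thm. 12.4 (1),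
  12.5 (1)–(3), 12.6, §16, Prop. 17.11 via Wuthrich 2014 p. 391, §17.13; Greenberg LNM 1716 §2) with
  `p := 2` and NO `p ≠ 2` binder: for every globally minimal elliptic `W/ℚ` non-split multiplicative
  at `2`, the cyclotomic `ℤ₂`-tower `κ` with matching `γ`, newform `f`, MTT function `L`
  (`IsMultPAdicLFunctionOf f 2 (−1) L`), `I : IwasawaH1Data W 2 κ γ`, `D : W.SelmerDualData κ γ`, some
  `Kato2004.MultDivisibilityInputs W 2 L κ γ I D` (structure of the Literature file: fields = printed
  statements, «exact upto `×2^a`») has `length(𝐇²_loc)_𝔭 = 0` at the height-one `𝔭 ∌ 2`. WHAT IS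
  NOT IN PRINT AT `2`: only the field `col_injective` (Prop. 17.11 at a non-split `2`: Lemma 17.12's
  hypotheses hold verbatim at `T″(1) = ℤ₂(φ)`; the two extra `ℤ/2`'s — `Coker(Frob − 1 ∣ ℤ₂(φ))` and
  `𝐇²_loc(T′(k))` — are finite; audit-1's sheet `HOME/audit/D-AUDIT-K11a-Kato-mult-at-2-print-locator.md`
  §2 item 3 = reading `Kato17.11@2-nonsplit`; cell memos PROOF-MULT Thm. A / PROOF-KATO2MULT, referee
  RC-2 / RC-28 PASS); every other field is printed parity-free (same sheet §1). Nothing asserted.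
* `exists_multDivisibilityInputs_split_two` — **[K11b-Rat residue, MEMO] the same at a SPLIT
  multiplicative `2`, with the Coleman map of the singular quotient valued in `I = (T)`**
  (`Kato2004.exists_multDivisibilityInputs_split` with `p := 2`): NOT IN PRINT AT `2` = Kobayashi 2006
  Thm. 4.1 at `2` (cell memo PROOF-KATO2SPLIT §4: Lemma N — the corestriction from `ℚ₂(ζ_{2^∞})` to the
  `ℤ₂`-tower is surjective one layer up; Lemma S — integrality of the descended regulator; referee
  RC-35 / RC-41 PASS). Nothing asserted.

With `Kato2004.nonempty_iwasawaH1Data`, `Kato2004.thm12_4` (accepted Literature facts, any prime) and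
Greenberg's Thm. 1.5, these two constants give the cell's prime-`2` binder
`X5.O1.KatoMultiplicativeDivisibilityRat W 2` (K11a / K11b-Rat) by the PROVED §17.13 module theory
(`ByReductionTypeAtTwoMultKatoRatOfInputs.lean`). HONEST FRAMING (cell `bsd-2adic`, HUMAN RULINGS
D-0036 / D-0054): memo-grade constants DISPLAYED by name, not Literature facts and not kernel
theorems; rows through them are NO-OFFER until the desk rules on the located residue (one field per
sign). PARTITION: X5@2 multiplicative (K4ᵐ, B1·O1; 1 976 book230 classes) × p = 2 —
types-the-object-of; closes none; nothing booked.

References: [Kato2004Asterisque] Thm. 12.4, 12.5, 12.6 (pp. 221–222), §16 (pp. 268–271), Prop. 17.11,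
Lemma 17.12, §17.13 (pp. 277–280); [Wuthrich2014] p. 391, Cor. 19; [Kobayashi2006DocMath] Thm. 4.1;
[GreenbergLNM1716] §2; [MazurTateTeitelbaum1986] §I.10, §I.14–15; cell memos HOME/mult/PROOF-MULT.md,
PROOF-KATO2MULT.md, PROOF-KATO2SPLIT.md, KERNEL-K11-INPUTS.md.
-/

set_option autoImplicit false
-- the Theorems namespace of this sub repeats the summit name by design (D-0017 nested layout: Summit.<S>.<Sub>)
set_option linter.dupNamespace false

noncomputable section

open scoped Classical MatrixGroups ModularForm

open Field CongruenceSubgroup WeierstrassCurve Literature.NumberTheory.EllipticCurves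
  Literature.NumberTheory.EllipticCurves.ModularForms

namespace Summit.BirchSwinnertonDyer.BirchSwinnertonDyer.Theorems.MultKatoInputs

/-- **[K11a residue at `2`, MEMO-grade] Kato's §17.13 inputs exist at a NON-SPLIT multiplicative `2`,
with vanishing `𝐇²_loc`-term at the height-one `𝔭 ∌ 2`** — the `p := 2` sibling of the Literature
construction fact `Kato2004.exists_multDivisibilityInputs_nonsplit` (printed for odd `p`). The only
field not in print at `2` is the injectivity of the Coleman map on the singular quotient (Prop. 17.11
at a non-split `2`; Lemma 17.12 applies verbatim at `ℤ₂(φ)`; cell memos PROOF-MULT / PROOF-KATO2MULT,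
referee RC-2 / RC-28 PASS; audit sheet reading `Kato17.11@2-nonsplit`). Nothing asserted.
[cite: Kato2004Asterisque, Thm. 12.5 (1)–(3) (pp. 221–222), Lemma 17.12 (p. 278), §17.13 (pp. 279–280) (shape; p ∤ N / odd p in print)]
[cite: Wuthrich2014, p. 391 (Prop. 17.11 at a non-split multiplicative prime; odd p)] -/
@[conjecture] def exists_multDivisibilityInputs_nonsplit_two : Prop :=
  ∀ (W : WeierstrassCurve ℚ) [W.IsElliptic] [W.IsGloballyMinimal]
    [ContinuousSMul ℤ_[2] (W.tateModule 2)] {N : ℕ} [NeZero N] (f : CuspForm (Gamma0 N) 2)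
    (κ : ZpExtension ℚ 2) (γ : absoluteGaloisGroup ℚ),
    W.HasMultiplicativeReductionAtPrime 2 → ¬ W.HasSplitMultiplicativeReductionAtPrime 2 →
    κ.IsCyclotomic → κ.IsTopGenerator γ → IsCyclotomicVariable 2 γ → IsNewformOf W f →
    ∀ (L : PowerSeries ℚ_[2]), IsMultPAdicLFunctionOf f 2 (-1) L →
    ∀ (I : Kato2004.IwasawaH1Data W 2 κ γ) (D : W.SelmerDualData κ γ),
      ∃ K : Kato2004.MultDivisibilityInputs W 2 L κ γ I D,
        ∀ 𝔭 : PrimeSpectrum (IwasawaAlgebra 2), 𝔭.asIdeal.height = 1 →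
          PowerSeries.C (2 : ℤ_[2]) ∉ 𝔭.asIdeal →
            Literature.NumberTheory.EllipticCurves.Module.lengthAt (IwasawaAlgebra 2) K.H2loc 𝔭 = 0

/-- **[K11b-Rat residue at `2`, MEMO-grade] Kato's §17.13 inputs exist at a SPLIT multiplicative `2`,
with the Coleman map of the singular quotient valued in the augmentation ideal `(T)`** — the `p := 2`
sibling of `Kato2004.exists_multDivisibilityInputs_split` (printed for odd `p`: Kobayashi 2006 Thm. 4.1
via Wuthrich 2014 p. 391). Not in print at `2` (cell memo PROOF-KATO2SPLIT §4 Lemma N / Lemma S,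
referee RC-35 / RC-41 PASS). Nothing asserted.
[cite: Kato2004Asterisque, Thm. 12.5 (3) (p. 222), §17.13 (pp. 279–280), Remark 18.3 (p. 281) (shape; odd p in print)]
[cite: Kobayashi2006DocMath, Thm. 4.1 (Coleman map of the Tate curve into I; odd p)] -/
@[conjecture] def exists_multDivisibilityInputs_split_two : Prop :=
  ∀ (W : WeierstrassCurve ℚ) [W.IsElliptic] [W.IsGloballyMinimal]
    [ContinuousSMul ℤ_[2] (W.tateModule 2)] {N : ℕ} [NeZero N] (f : CuspForm (Gamma0 N) 2)
    (κ : ZpExtension ℚ 2) (γ : absoluteGaloisGroup ℚ),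
    W.HasSplitMultiplicativeReductionAtPrime 2 →
    κ.IsCyclotomic → κ.IsTopGenerator γ → IsCyclotomicVariable 2 γ → IsNewformOf W f →
    ∀ (L : PowerSeries ℚ_[2]), IsSplitMultPAdicLFunctionOf f 2 L →
    ∀ (I : Kato2004.IwasawaH1Data W 2 κ γ) (D : W.SelmerDualData κ γ),
      ∃ K : Kato2004.MultDivisibilityInputs W 2 L κ γ I D,
        ∀ y : K.P, K.col y ∈ Ideal.span {(PowerSeries.X : IwasawaAlgebra 2)}

end Summit.BirchSwinnertonDyer.BirchSwinnertonDyer.Theorems.MultKatoInputs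

end
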